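import Summits.RiemannHypothesis.RiemannHypothesis.Theorems.WeilWindowFlowDiniLeakageRelEdgeMassLaw

/-!
# Crux `WeilWindowFlow.DiniLeakage` (stmt-RiemannHypothesis-1038) — the universal one-stub skeleton
(line lead c1, prover-line-stmt-RiemannHypothesis-1038-c1-0, 2026-08-16; EVIDENCE, not a proposal)

The tree THEOREM
`Summit.RiemannHypothesis.RiemannHypothesis.Theorems.WeilWindowFlowDiniLeakage.diniLeakage_iff_mathlib_riemannHypothesis :
   DiniLeakage ↔ _root_.RiemannHypothesis`
(`Theorems/WeilWindowFlowDiniLeakageRelEdgeMassLaw.lean`, p90716; = the landed calibration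
`DiniLeakage ↔ RiemannHypothesis ∧ WindowLipschitz` (p88520) + the landed `WindowLipschitz_proof` of item 1039)
makes every skeleton for this crux an instance of the one below: its stubs jointly prove RH
(`riemannHypothesis_of_crux` applied to the skeleton's `DiniLeakage_of`), and RH alone proves the crux
(`DiniLeakage_of` here).  The registered lines instantiate it as follows (all three calibrations are kernel-checked):

* `collar-cut-edge-mass`: only open stub B♭ `stub_relEdgeMassLaw`, and
  `relEdgeMassLaw_iff_riemannHypothesis : B♭ ↔ RiemannHypothesis` (same tree file);
* `radical-shadow-slepian-edge`: bet S1 `stub_shadowCore`; the skeleton's own sorry-free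
  `shadowCore_of_strictFloor` gives S1 from a positive floor of `ε` on compact ranges, i.e. from RH
  (`strictUnderRH_proof` + `continuousOn_weilGroundEnergy_Icc`, exactly as in
  `relEdgeMassLaw_of_riemannHypothesis_of_absEdgeMassLaw`), with the EMPTY block; conversely
  S1 ∧ S2 ∧ S3 ∧ S4 ⟹ crux (`diniLeakage_of_stubs`) ⟹ RH;
* `spectral-virial-shadow`: bet S `stub_shadowBound`; S ∧ F ∧ P ∧ T ⟹ crux (`leakageStep_of`,
  `DiniLeakage_of`) ⟹ RH; conversely, modulo F/P/T, RH ∧ `WindowLipschitz` (proved) reduce S to an ABSOLUTE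
  bound on the finite-difference dilation cost `[Q(weilDilate (h/a) u) − Q(u)]/h` of true ground states — a
  1039-type regularity statement — because `K` is free per range and `ε ≥ min_{[b₀,A+1]} ε > 0` under RH.

So the state of the art for item 1038 is: closed modulo exactly `RiemannHypothesis`, nothing else.
-/

namespace Summit.RiemannHypothesis.RiemannHypothesis.Cruxes.DiniLeakage.CruxIsSummit

open Summit.RiemannHypothesis.RiemannHypothesis.Theses.WeilWindowFlow (DiniLeakage)
open Summit.RiemannHypothesis.RiemannHypothesis.Theorems.WeilWindowFlowDiniLeakage
  (diniLeakage_iff_mathlib_riemannHypothesis)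

/-- The only stub: Mathlib's Riemann hypothesis (the summit `Summit.RiemannHypothesis`, definitionally). -/
theorem stub_riemannHypothesis : _root_.RiemannHypothesis := by
  sorry

/-- Composition: concludes the crux BY NAME from the single stub, through the tree theorem
`diniLeakage_iff_mathlib_riemannHypothesis`. -/
theorem DiniLeakage_of : DiniLeakage :=
  diniLeakage_iff_mathlib_riemannHypothesis.mpr stub_riemannHypothesis

/-- Conversely ANY proof term of the crux — in particular the composition `DiniLeakage_of` of any line's
stubs — is a proof of the Riemann hypothesis. -/
theorem riemannHypothesis_of_crux (h : DiniLeakage) : _root_.RiemannHypothesis :=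
  diniLeakage_iff_mathlib_riemannHypothesis.mp h

end Summit.RiemannHypothesis.RiemannHypothesis.Cruxes.DiniLeakage.CruxIsSummit
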